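import Summits.BirchSwinnertonDyer.Rank1Residual.P2.KrizLiTwistMinimalModels
import Summits.BirchSwinnertonDyer.Rank1Residual.P2.KrizLiJZeroBasesMembership
import Summits.BirchSwinnertonDyer.Rank1Residual.P2.KrizLiCubeSumThirteenCurve
import HarnessLib

/-!
# Cell `bsd-print-cf2` (D-0131 (2) PRINT TIER, leaf CornerF @ `p = 2`), typer ty2 — the minimal model of a
# Kriz–Li twist ON THE NOSE at the four (★)-certified `j = 0` bases GOOD at `2` other than `243a1`:
# `1323a1 = E₆₀₀`, `1323m1 = E₋₂`, `4563a1 = E₉₂₈₂₃`, `4563b1 = E₄₂` (`E_a : y² + y = x³ + a`)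

HONEST FRAMING (cell `bsd-print-cf2`, run/shared/lean/pub/bsd-print-cf2/; verbatim): PARTITION currency only
— the leaf `Summit.BirchSwinnertonDyer.WAllCornerFTwo` counts when its class theorem is in the kernel BY NAME;
every imported theorem carries its printed hypotheses verbatim. The leaf and crux `InertJZeroOfFacts`
(stmt-BirchSwinnertonDyer-20671) are OPEN AS CLASSES; nothing class-wide is closed; THEOREMS ONLY — no
definition, no named fact; Assumption (★) enters only as the displayed binder `hSD : P2.HasKrizLiStarDatum E K`
(a CERTIFICATE at these bases — lit dossier §14.4/§14.8 — not print).

Companion of `P2/KrizLiTwistMinimalModels.lean` (generic part: per-prime Silverman/Kraus criterion, the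
twist models of the two shapes, the `E`-generic and `a`-generic conclusion on the nose). For each base `E_a` here
(`4a + 1 = t = 7⁴, −7, 13⁵, 13²`; conductor `3³·7²` resp. `3³·13²`, good at `2` — the INERT-GOOD quadrant),
in EXACTLY the binders of ty2 g3's membership theorems `isIsogenousToKrizLiTwistOfSmallCMBase_of_curveX`
(`K` imaginary quadratic with `(d_K/3) = (d_K/q) = 1`, a displayed (★)-datum, `d ∈ 𝒩(E, K)`, `d > 0`,
`d ≡ 1 (mod 12)`, `q ∤ d`; for `4563b1` p3's `_of_field` binders `hH`, `hsign`):

* `base_criterion_curveX` — `q¹² ∤ 27t²` at every prime (the finite check, `norm_num`);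
* `isGloballyMinimal_twistModel_curveX` — the model `E_k = y² + y = x³ + k`, `4k + 1 = t·d³`, of `E^{(d)}`
  (`P2.smul_quadraticTwist_cubicA₃_eq`: shift `y ↦ y + ½`) is GLOBALLY MINIMAL (`Δ = −27t²d⁶`: the primes of
  `d` are `∉ {3, q}`, square-free; Silverman VII.1 Rem. 1.1);
* `analyticRank_eq_one_and_bsdp_two_twistModel_curveX` — `ord_{s=1} L(E_k, s) = 1 ∧ BSD(E_k, 2)` BY NAME,
  granted the seven facts `hKL h33 hS31 hBF hmod hGZK hCassels` of p3's transport and `hSD`;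
* `curve4563b1_eq_cubicA₃`, `curve243a1_eq_cubicA₃` — p3's two `def` bases in the `a`-generic vocabulary
  (`243a1`'s twist model on the nose is ty3's `P2/CornerFTwoCertificatesKrizLi`, not repeated).

What a ty3 record glue does with it: decode `r.ainvs = [0,0,1,0,k]` and the rechecked `4k + 1 = t·d³`, feed
`d`'s explicit data to g3's `inN_curveX_of_explicit`, and read off the record's curve ON THE NOSE. Currency
LITERAL-by-name((★)-display); beyond-print theorem: NO. References: [KrizLi2019] Thm 5.1 (2) = arXiv:1606.03172
Thm 1.12, Def 4.1, Thm 4.3, §6 Ex. 6.2; [SilvermanAEC2009] VII.1 Remark 1.1, X.5 Prop. 5.4; [Cremona1997]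
Table 1 (1323a1, 1323m1, 4563a1, 4563b1, 243a1); [CreutzMiller2012] Thm 1.1; [BurungaleFlach2024] Thm 1.1,
Cor. 2; [MilneADT2006] Thm I.7.3; cell dossier §14.4; tree `P2/KrizLiThirteenTwentyThree`,
`P2/KrizLiFortyFiveSixtyThree`, `P2/KrizLiJZeroBasesMembership` (ty2 g3), `P2/KrizLiCubeSumThirteenCurve`,
`P2/KrizLiTwoFortyThreeCurve` (p3).
-/

noncomputable section

open scoped Classical

open WeierstrassCurve NumberField Literature.NumberTheory.EllipticCurves
  Literature.NumberTheory.EllipticCurves.Rank1Residual Literature.NumberTheory.EllipticCurves.ModularForms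
  Literature.NumberTheory.EllipticCurves.Rank1Residual.X11RankOneCertificates
  Summit.BirchSwinnertonDyer.Rank1Residual

set_option autoImplicit false

namespace Summit.BirchSwinnertonDyer.Rank1Residual.P2

/-! ## The base criteria (finite checks) -/

/-- The base criterion at `1323a1 = E₆₀₀`: `q¹² ∤ 27·(7⁴)² = 155649627`. [cite: Cremona1997, Table 1 (1323a1)] -/
theorem base_criterion_curve1323a1 : ∀ q : ℕ, q.Prime → ¬ (q : ℤ) ^ 12 ∣ 27 * (4 * (600 : ℤ) + 1) ^ 2 :=
  not_intCast_pow_twelve_dvd_of_natAbs_eq 155649627 4 (by norm_num) (by norm_num) (by norm_num)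
    (by intro q hq hq4; have := hq.two_le; interval_cases q <;> norm_num)

/-- The base criterion at `1323m1 = E₋₂`: `q¹² ∤ 27·7² = 1323`. [cite: Cremona1997, Table 1 (1323m1)] -/
theorem base_criterion_curve1323m1 : ∀ q : ℕ, q.Prime → ¬ (q : ℤ) ^ 12 ∣ 27 * (4 * (-2 : ℤ) + 1) ^ 2 :=
  not_intCast_pow_twelve_dvd_of_natAbs_eq 1323 1 (by norm_num) (by norm_num) (by norm_num)
    (by intro q hq hq1; have := hq.two_le; omega)

/-- The base criterion at `4563a1 = E₉₂₈₂₃`: `q¹² ∤ 27·(13⁵)² = 3722179279923`. [cite: Cremona1997, Table 1 (4563a1)] -/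
theorem base_criterion_curve4563a1 : ∀ q : ℕ, q.Prime → ¬ (q : ℤ) ^ 12 ∣ 27 * (4 * (92823 : ℤ) + 1) ^ 2 :=
  not_intCast_pow_twelve_dvd_of_natAbs_eq 3722179279923 11 (by norm_num) (by norm_num) (by norm_num)
    (by intro q hq hq11; have := hq.two_le; interval_cases q <;> norm_num)

/-- The base criterion at `4563b1 = E₄₂`: `q¹² ∤ 27·(13²)² = 771147`. [cite: Cremona1997, Table 1 (4563b1)] -/
theorem base_criterion_curve4563b1 : ∀ q : ℕ, q.Prime → ¬ (q : ℤ) ^ 12 ∣ 27 * (4 * (42 : ℤ) + 1) ^ 2 :=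
  not_intCast_pow_twelve_dvd_of_natAbs_eq 771147 3 (by norm_num) (by norm_num) (by norm_num)
    (by intro q hq hq3; have := hq.two_le; interval_cases q <;> norm_num)

/-! ## `1323a1 = E₆₀₀` and `1323m1 = E₋₂` (good at `2`; `N = 3³·7²`; twist model `E_k`, `4k + 1 = 7⁴d³`, `−7d³`) -/

/-- **The twist model `E_k ≅ 1323a1^{(d)}` (`4k + 1 = 7⁴·d³`) is globally minimal** for `d` square-free,
`d ≡ 1 (mod 12)`, `7 ∤ d`. [cite: SilvermanAEC2009, VII.1 Remark 1.1 and X.5 Prop. 5.4] [cite: Cremona1997, Table 1 (1323a1)] -/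
theorem isGloballyMinimal_twistModel_curve1323a1 {d k : ℤ} (hk : 4 * k + 1 = d ^ 3 * 2401)
    (hsq : Squarefree d.natAbs) (hd12 : d % 12 = 1) (hqd : ¬ (7 : ℤ) ∣ d) : (cubicA₃ k).IsGloballyMinimal :=
  isGloballyMinimal_cubicA₃_twist 600 (by rw [hk]; norm_num) hsq
    (not_dvd_of_natAbs_eq_pow_three_mul_pow hd12 (by norm_num : (7 : ℕ).Prime) (by exact_mod_cast hqd)
      (j := 4) (by norm_num))
    base_criterion_curve1323a1

/-- **`1323a1^{(d)}` ON THE NOSE**: in any imaginary quadratic `K` with `(d_K/3) = (d_K/7) = 1` carrying a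
(★)-datum (DISPLAYED certificate `hSD`), for `d ∈ 𝒩(1323a1, K)`, `d > 0`, `d ≡ 1 (mod 12)`, `7 ∤ d` — the binders
of `isIsogenousToKrizLiTwistOfSmallCMBase_of_curve1323a1` — the model `E_k = y² + y = x³ + k`, `4k + 1 = 7⁴d³`, is
globally minimal with `ord_{s=1} L(E_k, s) = 1 ∧ BSD(E_k, 2)`, granted BY NAME the seven facts.
[cite: KrizLi2019, Thm. 5.1 (2), Thm. 4.3, Def. 4.1, §6 Ex. 6.2] [cite: CreutzMiller2012, Thm. 1.1]
[cite: BurungaleFlach2024, Thm. 1.1 and Cor. 2] [cite: MilneADT2006, Thm. I.7.3] [cite: SilvermanAEC2009, VII.1 Remark 1.1] -/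
theorem analyticRank_eq_one_and_bsdp_two_twistModel_curve1323a1 (hKL : KrizLi2019.thm112_bsdTwo_twist)
    (h33 : KrizLi2019.thm33_rank_twist) (hS31 : bsdTriple_of_analyticRank_le_one_of_conductor_lt)
    (hBF : bsdTriple_of_hasCM_of_L_one_ne_zero) (hmod : hasEntireLFunction_rat)
    (hGZK : rank_eq_analyticRank_of_analyticRank_le_one) (hCassels : bsdRHS_eq_of_isIsogenous)
    {K : Type} [Field K] [NumberField K] (hK : IsImaginaryQuadratic K)
    (h3 : jacobiSym (NumberField.discr K) 3 = 1) (hq : jacobiSym (NumberField.discr K) 7 = 1)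
    (hSD : HasKrizLiStarDatum curve1323a1 K) {d k : ℤ} (hk : 4 * k + 1 = d ^ 3 * 2401)
    (hd : KrizLi2019.InN curve1323a1 K d) (hd0 : 0 < d) (hd12 : d % 12 = 1) (hqd : ¬ (7 : ℤ) ∣ d) :
    ∃ _ : (cubicA₃ k).IsGloballyMinimal, (cubicA₃ k).analyticRank = 1 ∧ BSDp (cubicA₃ k) 2 :=
  analyticRank_eq_one_and_bsdp_two_cubicA₃_twistModel 600 hKL h33 hS31 hBF hmod hGZK hCassels
    conductorNorm_curve1323a1_lt one_le_mordellWeilRank_curve1323a1 K hK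
    (satisfiesHeegnerHypothesis_curve1323a1 hK.1 h3 hq) hSD (by rw [hk]; norm_num) hd
    (sign_mul_jacobiSym_conductorNorm_curve1323a1 hd0 hd12 hqd)
    (not_dvd_of_natAbs_eq_pow_three_mul_pow hd12 (by norm_num : (7 : ℕ).Prime) (by exact_mod_cast hqd)
      (j := 4) (by norm_num))
    base_criterion_curve1323a1

/-- **The twist model `E_k ≅ 1323m1^{(d)}` (`4k + 1 = −7·d³`) is globally minimal** for `d` square-free,
`d ≡ 1 (mod 12)`, `7 ∤ d`. [cite: SilvermanAEC2009, VII.1 Remark 1.1 and X.5 Prop. 5.4] [cite: Cremona1997, Table 1 (1323m1)] -/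
theorem isGloballyMinimal_twistModel_curve1323m1 {d k : ℤ} (hk : 4 * k + 1 = d ^ 3 * (-7))
    (hsq : Squarefree d.natAbs) (hd12 : d % 12 = 1) (hqd : ¬ (7 : ℤ) ∣ d) : (cubicA₃ k).IsGloballyMinimal :=
  isGloballyMinimal_cubicA₃_twist (-2) (by rw [hk]; norm_num) hsq
    (not_dvd_of_natAbs_eq_pow_three_mul_pow hd12 (by norm_num : (7 : ℕ).Prime) (by exact_mod_cast hqd)
      (j := 1) (by norm_num))
    base_criterion_curve1323m1

/-- **`1323m1^{(d)}` ON THE NOSE** (binders of `isIsogenousToKrizLiTwistOfSmallCMBase_of_curve1323m1`): the model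
`E_k`, `4k + 1 = −7d³`, is globally minimal with `ord_{s=1} L(E_k, s) = 1 ∧ BSD(E_k, 2)`, granted BY NAME the
seven facts and the displayed (★)-datum. [cite: KrizLi2019, Thm. 5.1 (2), Thm. 4.3, Def. 4.1, §6 Ex. 6.2]
[cite: CreutzMiller2012, Thm. 1.1] [cite: BurungaleFlach2024, Thm. 1.1 and Cor. 2] [cite: MilneADT2006, Thm. I.7.3]
[cite: SilvermanAEC2009, VII.1 Remark 1.1] -/
theorem analyticRank_eq_one_and_bsdp_two_twistModel_curve1323m1 (hKL : KrizLi2019.thm112_bsdTwo_twist)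
    (h33 : KrizLi2019.thm33_rank_twist) (hS31 : bsdTriple_of_analyticRank_le_one_of_conductor_lt)
    (hBF : bsdTriple_of_hasCM_of_L_one_ne_zero) (hmod : hasEntireLFunction_rat)
    (hGZK : rank_eq_analyticRank_of_analyticRank_le_one) (hCassels : bsdRHS_eq_of_isIsogenous)
    {K : Type} [Field K] [NumberField K] (hK : IsImaginaryQuadratic K)
    (h3 : jacobiSym (NumberField.discr K) 3 = 1) (hq : jacobiSym (NumberField.discr K) 7 = 1)
    (hSD : HasKrizLiStarDatum curve1323m1 K) {d k : ℤ} (hk : 4 * k + 1 = d ^ 3 * (-7))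
    (hd : KrizLi2019.InN curve1323m1 K d) (hd0 : 0 < d) (hd12 : d % 12 = 1) (hqd : ¬ (7 : ℤ) ∣ d) :
    ∃ _ : (cubicA₃ k).IsGloballyMinimal, (cubicA₃ k).analyticRank = 1 ∧ BSDp (cubicA₃ k) 2 :=
  analyticRank_eq_one_and_bsdp_two_cubicA₃_twistModel (-2) hKL h33 hS31 hBF hmod hGZK hCassels
    conductorNorm_curve1323m1_lt one_le_mordellWeilRank_curve1323m1 K hK
    (satisfiesHeegnerHypothesis_curve1323m1 hK.1 h3 hq) hSD (by rw [hk]; norm_num) hd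
    (sign_mul_jacobiSym_conductorNorm_curve1323m1 hd0 hd12 hqd)
    (not_dvd_of_natAbs_eq_pow_three_mul_pow hd12 (by norm_num : (7 : ℕ).Prime) (by exact_mod_cast hqd)
      (j := 1) (by norm_num))
    base_criterion_curve1323m1

/-! ## `4563a1 = E₉₂₈₂₃` and `4563b1 = E₄₂` (good at `2`; `N = 3³·13²`; twist model `E_k`, `4k + 1 = 13⁵d³`, `13²d³`) -/

/-- **The twist model `E_k ≅ 4563a1^{(d)}` (`4k + 1 = 13⁵·d³`) is globally minimal** for `d` square-free,
`d ≡ 1 (mod 12)`, `13 ∤ d`. [cite: SilvermanAEC2009, VII.1 Remark 1.1 and X.5 Prop. 5.4] [cite: Cremona1997, Table 1 (4563a1)] -/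
theorem isGloballyMinimal_twistModel_curve4563a1 {d k : ℤ} (hk : 4 * k + 1 = d ^ 3 * 371293)
    (hsq : Squarefree d.natAbs) (hd12 : d % 12 = 1) (hqd : ¬ (13 : ℤ) ∣ d) : (cubicA₃ k).IsGloballyMinimal :=
  isGloballyMinimal_cubicA₃_twist 92823 (by rw [hk]; norm_num) hsq
    (not_dvd_of_natAbs_eq_pow_three_mul_pow hd12 (by norm_num : (13 : ℕ).Prime) (by exact_mod_cast hqd)
      (j := 5) (by norm_num))
    base_criterion_curve4563a1

/-- **`4563a1^{(d)}` ON THE NOSE** (binders of `isIsogenousToKrizLiTwistOfSmallCMBase_of_curve4563a1`): the model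
`E_k`, `4k + 1 = 13⁵d³`, is globally minimal with `ord_{s=1} L(E_k, s) = 1 ∧ BSD(E_k, 2)`, granted BY NAME the
seven facts and the displayed (★)-datum. [cite: KrizLi2019, Thm. 5.1 (2), Thm. 4.3, Def. 4.1, §6 Ex. 6.2]
[cite: CreutzMiller2012, Thm. 1.1] [cite: BurungaleFlach2024, Thm. 1.1 and Cor. 2] [cite: MilneADT2006, Thm. I.7.3]
[cite: SilvermanAEC2009, VII.1 Remark 1.1] -/
theorem analyticRank_eq_one_and_bsdp_two_twistModel_curve4563a1 (hKL : KrizLi2019.thm112_bsdTwo_twist)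
    (h33 : KrizLi2019.thm33_rank_twist) (hS31 : bsdTriple_of_analyticRank_le_one_of_conductor_lt)
    (hBF : bsdTriple_of_hasCM_of_L_one_ne_zero) (hmod : hasEntireLFunction_rat)
    (hGZK : rank_eq_analyticRank_of_analyticRank_le_one) (hCassels : bsdRHS_eq_of_isIsogenous)
    {K : Type} [Field K] [NumberField K] (hK : IsImaginaryQuadratic K)
    (h3 : jacobiSym (NumberField.discr K) 3 = 1) (hq : jacobiSym (NumberField.discr K) 13 = 1)
    (hSD : HasKrizLiStarDatum curve4563a1 K) {d k : ℤ} (hk : 4 * k + 1 = d ^ 3 * 371293)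
    (hd : KrizLi2019.InN curve4563a1 K d) (hd0 : 0 < d) (hd12 : d % 12 = 1) (hqd : ¬ (13 : ℤ) ∣ d) :
    ∃ _ : (cubicA₃ k).IsGloballyMinimal, (cubicA₃ k).analyticRank = 1 ∧ BSDp (cubicA₃ k) 2 :=
  analyticRank_eq_one_and_bsdp_two_cubicA₃_twistModel 92823 hKL h33 hS31 hBF hmod hGZK hCassels
    conductorNorm_curve4563a1_lt one_le_mordellWeilRank_curve4563a1 K hK
    (satisfiesHeegnerHypothesis_curve4563a1 hK.1 h3 hq) hSD (by rw [hk]; norm_num) hd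
    (sign_mul_jacobiSym_conductorNorm_curve4563a1 hd0 hd12 hqd)
    (not_dvd_of_natAbs_eq_pow_three_mul_pow hd12 (by norm_num : (13 : ℕ).Prime) (by exact_mod_cast hqd)
      (j := 5) (by norm_num))
    base_criterion_curve4563a1

/-- p3's `curve4563b1 = [0,0,1,0,42]` IS `E₄₂` in the `a`-generic vocabulary. [cite: Cremona1997, Table 1 (4563b1)] -/
theorem curve4563b1_eq_cubicA₃ : curve4563b1 = cubicA₃ 42 := by
  rw [curve4563b1, cubicA₃_eq]; norm_num

/-- p3's `curve243a1 = [0,0,1,0,−1]` IS `E₋₁` in the `a`-generic vocabulary (the printed fibre; its twist model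
on the nose is ty3's `smul_quadraticTwist_curve243a1_eq_intModel` / `isGloballyMinimal_model243`).
[cite: Cremona1997, Table 1 (243a1)] -/
theorem curve243a1_eq_cubicA₃ : curve243a1 = cubicA₃ (-1) := by
  rw [curve243a1, cubicA₃_eq]; norm_num

/-- **The twist model `E_k ≅ 4563b1^{(d)}` (`4k + 1 = 13²·d³`) is globally minimal** for `d` square-free,
`d ≡ 1 (mod 12)`, `13 ∤ d`. [cite: SilvermanAEC2009, VII.1 Remark 1.1 and X.5 Prop. 5.4] [cite: Cremona1997, Table 1 (4563b1)] -/
theorem isGloballyMinimal_twistModel_curve4563b1 {d k : ℤ} (hk : 4 * k + 1 = d ^ 3 * 169)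
    (hsq : Squarefree d.natAbs) (hd12 : d % 12 = 1) (hqd : ¬ (13 : ℤ) ∣ d) : (cubicA₃ k).IsGloballyMinimal :=
  isGloballyMinimal_cubicA₃_twist 42 (by rw [hk]; norm_num) hsq
    (not_dvd_of_natAbs_eq_pow_three_mul_pow hd12 (by norm_num : (13 : ℕ).Prime) (by exact_mod_cast hqd)
      (j := 2) (by norm_num))
    base_criterion_curve4563b1

/-- `4563b1^{(d)} ≅ E_k` on the nose (`4k + 1 = 13²d³`, shift `y ↦ y + ½`). [cite: SilvermanAEC2009, III.1 and X.5 Prop. 5.4] -/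
theorem smul_quadraticTwist_curve4563b1_eq_cubicA₃ {d k : ℤ} (hk : 4 * k + 1 = d ^ 3 * 169) :
    (⟨1, 0, 0, 2⁻¹⟩ : VariableChange ℚ) • curve4563b1.quadraticTwist (d : ℚ) = cubicA₃ k := by
  rw [curve4563b1_eq_cubicA₃]
  exact smul_quadraticTwist_cubicA₃_eq 42 (by rw [hk]; norm_num)

/-- **`4563b1^{(d)}` ON THE NOSE** (binders of p3's `bsdp_two_of_isIsogenous_twist_curve4563b1_of_field`, plus
`d ≡ 1 (mod 12)`, `13 ∤ d` for the model): over any imaginary quadratic `K` with the Heegner hypothesis for `N(E)`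
and a displayed (★)-datum, for `d ∈ 𝒩(4563b1, K)` with `χ_d(−N) = 1`, the model `E_k`, `4k + 1 = 13²d³`, is
globally minimal with `ord_{s=1} L(E_k, s) = 1 ∧ BSD(E_k, 2)`, granted BY NAME the seven facts.
[cite: KrizLi2019, Thm. 5.1 (2), Thm. 4.3, Def. 4.1] [cite: CreutzMiller2012, Thm. 1.1]
[cite: BurungaleFlach2024, Thm. 1.1 and Cor. 2] [cite: MilneADT2006, Thm. I.7.3] [cite: SilvermanAEC2009, VII.1 Remark 1.1] -/
theorem analyticRank_eq_one_and_bsdp_two_twistModel_curve4563b1 (hKL : KrizLi2019.thm112_bsdTwo_twist)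
    (h33 : KrizLi2019.thm33_rank_twist) (hS31 : bsdTriple_of_analyticRank_le_one_of_conductor_lt)
    (hBF : bsdTriple_of_hasCM_of_L_one_ne_zero) (hmod : hasEntireLFunction_rat)
    (hGZK : rank_eq_analyticRank_of_analyticRank_le_one) (hCassels : bsdRHS_eq_of_isIsogenous)
    (K : Type) [Field K] [NumberField K] (hK : IsImaginaryQuadratic K)
    (hH : SatisfiesHeegnerHypothesis (curve4563b1.conductorNorm ℤ) K) (hSD : HasKrizLiStarDatum curve4563b1 K)
    {d k : ℤ} (hk : 4 * k + 1 = d ^ 3 * 169) (hd : KrizLi2019.InN curve4563b1 K d)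
    (hsign : Int.sign d * jacobiSym (curve4563b1.conductorNorm ℤ) d.natAbs = 1) (hd12 : d % 12 = 1)
    (hqd : ¬ (13 : ℤ) ∣ d) :
    ∃ _ : (cubicA₃ k).IsGloballyMinimal, (cubicA₃ k).analyticRank = 1 ∧ BSDp (cubicA₃ k) 2 := by
  haveI hmin := isGloballyMinimal_twistModel_curve4563b1 hk hd.2.1 hd12 hqd
  exact ⟨hmin, analyticRank_eq_one_and_bsdp_two_of_smul_twist_of_hasKrizLiStarDatum curve4563b1 hKL h33 hS31
    hBF hmod hGZK hCassels hasCM_curve4563b1 conductorNorm_curve4563b1_lt one_le_mordellWeilRank_curve4563b1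
    twoTorsion_curve4563b1 odd_localTamagawaNumber_two_curve4563b1 K hK hH hSD hd hsign (cubicA₃ k)
    (smul_quadraticTwist_curve4563b1_eq_cubicA₃ hk)⟩

end Summit.BirchSwinnertonDyer.Rank1Residual.P2

end
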